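/-
Copyright (c) 2026. Released under the Apache 2.0 license.
-/
import Literature.NumberTheory.EllipticCurves.ManinConstantClassCertificateKodaira
import Literature.NumberTheory.EllipticCurves.ManinConstantModularDegree
import HarnessLib

/-!
# A seventh source of `ClassAbsManinConstantEqOne W`: at each square prime, Edixhoven 1991 Thm. 3,
# OR Kodaira type `Iₙ*` at an odd prime, OR a displayed twist witness, OR the modular degree
# (Česnavičius–Neururer–Saha 2024 Thm. 1.2, row "`0` otherwise")

The `Γ₀` twist road (`ManinConstantClassCertificateTwistGamma0Proofs.lean`, named predicate
`IsEdixhovenKodairaTwistCovered` of `ManinConstantClassCertificateKodaira.lean`) certifies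
`ClassAbsManinConstantEqOne W` from a key at EVERY square prime `p` of the conductor of EVERY
globally minimal member `W'` of the class; the primes with `p² ∤ N(W')` are Česnavičius 2018
Thm. 1.2 by name (`cesnavicius2018_not_dvd_maninConstant_of_not_sq_dvd_level`, binders
`hM hAU hC`). This file adds a FOURTH admissible key at a square prime, served by the tree's named
fact `cesnaviciusNeururerSaha_padicVal_maninConstant_le_modularDegree`
(`ManinConstantModularDegree.lean`, Česnavičius–Neururer–Saha, JEMS 26 (2024) Thm. 1.2, the row
"`0` otherwise" of the printed clause, for EVERY surjection `X₀(N)_ℚ ↠ E`, optimal or not):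

* the printed correction term vanishes, `cesnaviciusNeururerSahaCorrection (N(W')) p = 0` (automatic
  at `p ≥ 5`; at `p = 3`: `27 ∤ N` or a prime `q ≡ 2 (mod 3)` divides `N`; at `p = 2`: `8 ∤ N` or a
  prime `q ≡ 3 (mod 4)` divides `N`), AND `p ∤ deg(D')` for every lattice-optimal `X₀(N(W'))`-datum
  `D'` of `W'` (for such a datum `φ_{D'}` is the optimal parametrisation followed by an isomorphism
  `ℂ/Λ_f ≅ W'(ℂ)`, so `deg(D')` is the modular degree `m_f` of the optimal quotient of the class).

CAVEAT (data, not mathematics; see the provenance paragraph of `ManinConstantModularDegree.lean`):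
Cremona's ecdata `alldegphi` above `N ≈ 14000` is Watkins's `sympow` value `deg φ / c²` recorded
under the assumption `c = 1` (Cremona, ANTS-VII (2006) §2.4/§3.6; Watkins, Experiment. Math. 11
(2002) (1-1), p. 489–490). On a class whose optimal curve and Manin constant are not independently
determined (Cremona `opt_man` code `≥ 2`, i.e. every `N > 400000` class with an undetermined optimal
curve) that value is `m_f / c_opt²`, so `p ∤ alldegphi` certifies `val_p(m_f) = 2·val_p(c_opt)` and
the fourth key then reads `val_p(c_opt) ≤ 2·val_p(c_opt)` — no information: `alldegphi` does NOT
instantiate `hdeg : ∀ D' lattice-optimal, ¬ p ∣ D'.modularDegree` there. The key is served by an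
EXACT, Manin-free `m_f` (full modular-symbol space at level `N`), and is moot where `c = 1` is
already established. The theorems of this file are unaffected; only that instantiation is.

Then `val_p(c(D')) ≤ val_p(deg(D')) = 0`, so `p ∤ c(D')` at that prime with NO twist partner, NO
Kodaira condition and NO optimality beyond the datum itself
(`not_dvd_maninConstant_of_correction_eq_zero_of_not_dvd_modularDegree`). The class predicate
`IsEdixhovenKodairaTwistDegreeCovered W` names the four-way disjunction; the constructor
`classAbsManinConstantEqOne_of_isEdixhovenKodairaTwistDegreeCovered` carries the binders of the
`Γ₀` road, `hM hAU hC hEA hEB hnf`, plus `hCNS` (the ČNS fact), and nothing else;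
`IsEdixhovenKodairaTwistCovered W → IsEdixhovenKodairaTwistDegreeCovered W`. A modular-degree-only
form (`…_of_forall_sq_prime_modularDegree`, binders `hM hAU hC hnf hCNS`) and the binder /
valuation forms consumers carry are given too. No new named fact; nothing here is new mathematics
beyond the files it imports.

## References

* [CesnaviciusNeururerSaha2023] K. Česnavičius, M. Neururer, A. Saha, *The Manin constant and the
  modular degree*, JEMS 26 (2024) 573–637, Thm. 1.2 (arXiv:1911.09446).
* [EdixhovenManin1991] B. Edixhoven, Progr. Math. 89 (1991), §1 and Thm. 3.
* [Cesnavicius2018] K. Česnavičius, Compositio Math. 154 (2018), Thm. 1.2.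
* [Stevens1989] G. Stevens, Invent. Math. 98 (1989), Lemmas (5.2), (5.4).
* [Mazur1978] B. Mazur, Invent. Math. 44 (1978), Cor. 4.1.
* J. E. Cremona, *Algorithms for modular elliptic curves*, 2nd ed. (1997), §2.10 (`deg φ`); ecdata
  `alldegphi` (provenance: Cremona, ANTS-VII, LNCS 4076 (2006) §2.4, §3.6; M. Watkins, Experiment.
  Math. 11 (2002) 487–502).
-/

noncomputable section

open scoped MatrixGroups ModularForm

open CongruenceSubgroup WeierstrassCurve

namespace Literature.NumberTheory.EllipticCurves.ModularForms

/-! ### The modular-degree key at one prime -/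

/-- If the printed correction term `ε_p(N)` of ČNS Thm. 1.2 vanishes then the first exceptional
clause (`p = 2`, `8 ∣ N`, no prime `q ≡ 3 (mod 4)` dividing `N`) does not hold.
[cite: CesnaviciusNeururerSaha2023, Thm. 1.2] -/
theorem not_clause_two_of_cesnaviciusNeururerSahaCorrection_eq_zero {N p : ℕ}
    (h : cesnaviciusNeururerSahaCorrection N p = 0) :
    ¬ (p = 2 ∧ 2 ^ 3 ∣ N ∧ ∀ q : ℕ, q.Prime → q ∣ N → q % 4 ≠ 3) := by
  intro h2
  unfold cesnaviciusNeururerSahaCorrection at h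
  rw [if_pos (Or.inl h2)] at h
  exact one_ne_zero h

/-- If the printed correction term `ε_p(N)` of ČNS Thm. 1.2 vanishes then the second exceptional
clause (`p = 3`, `27 ∣ N`, no prime `q ≡ 2 (mod 3)` dividing `N`) does not hold.
[cite: CesnaviciusNeururerSaha2023, Thm. 1.2] -/
theorem not_clause_three_of_cesnaviciusNeururerSahaCorrection_eq_zero {N p : ℕ}
    (h : cesnaviciusNeururerSahaCorrection N p = 0) :
    ¬ (p = 3 ∧ 3 ^ 3 ∣ N ∧ ∀ q : ℕ, q.Prime → q ∣ N → q % 3 ≠ 2) := by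
  intro h3
  unfold cesnaviciusNeururerSahaCorrection at h
  rw [if_pos (Or.inr h3)] at h
  exact one_ne_zero h

/-- At an odd prime `p ≠ 3` the correction term vanishes at every level.
[cite: CesnaviciusNeururerSaha2023, Thm. 1.2] -/
theorem cesnaviciusNeururerSahaCorrection_eq_zero_of_ne_two_of_ne_three (N : ℕ) {p : ℕ}
    (hp2 : p ≠ 2) (hp3 : p ≠ 3) : cesnaviciusNeururerSahaCorrection N p = 0 :=
  cesnaviciusNeururerSahaCorrection_eq_zero (fun h ↦ hp2 h.1) (fun h ↦ hp3 h.1)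

/-- At `p = 3` the correction term vanishes when `27 ∤ N` or some prime `q ≡ 2 (mod 3)` divides `N`
(the census's side condition at `3`). [cite: CesnaviciusNeururerSaha2023, Thm. 1.2] -/
theorem cesnaviciusNeururerSahaCorrection_three_eq_zero {N : ℕ}
    (hN : ¬ 3 ^ 3 ∣ N ∨ ∃ q : ℕ, q.Prime ∧ q ∣ N ∧ q % 3 = 2) :
    cesnaviciusNeururerSahaCorrection N 3 = 0 := by
  refine cesnaviciusNeururerSahaCorrection_eq_zero (fun h ↦ by omega) fun h ↦ ?_
  rcases hN with h27 | ⟨q, hq, hqN, hq2⟩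
  · exact h27 h.2.1
  · exact h.2.2 q hq hqN hq2

/-- At `p = 2` the correction term vanishes when `8 ∤ N` or some prime `q ≡ 3 (mod 4)` divides `N`
(the census's side condition at `2`). [cite: CesnaviciusNeururerSaha2023, Thm. 1.2] -/
theorem cesnaviciusNeururerSahaCorrection_two_eq_zero {N : ℕ}
    (hN : ¬ 2 ^ 3 ∣ N ∨ ∃ q : ℕ, q.Prime ∧ q ∣ N ∧ q % 4 = 3) :
    cesnaviciusNeururerSahaCorrection N 2 = 0 := by
  refine cesnaviciusNeururerSahaCorrection_eq_zero (fun h ↦ ?_) fun h ↦ by omega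
  rcases hN with h8 | ⟨q, hq, hqN, hq3⟩
  · exact h8 h.2.1
  · exact h.2.2 q hq hqN hq3

/-- **The modular-degree key at one prime** (ČNS Thm. 1.2, row "`0` otherwise"): under the named
fact, for a datum `D` of a globally minimal `W` at the conductor level and a prime `p` with
`ε_p(N(W)) = 0` and `p ∤ deg(D)`: `p ∤ c(D)`. No optimality, no reduction-type hypothesis.
[cite: CesnaviciusNeururerSaha2023, Thm. 1.2] -/
theorem not_dvd_maninConstant_of_correction_eq_zero_of_not_dvd_modularDegree
    (hCNS : cesnaviciusNeururerSaha_padicVal_maninConstant_le_modularDegree)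
    (W : WeierstrassCurve ℚ) [W.IsElliptic] [W.IsGloballyMinimal] [NeZero (W.conductorNorm ℤ)]
    (D : ModularParametrizationData W (W.conductorNorm ℤ)) {p : ℕ} (hp : p.Prime)
    (hε : cesnaviciusNeururerSahaCorrection (W.conductorNorm ℤ) p = 0)
    (hdeg : ¬ p ∣ D.modularDegree) : ¬ (p : ℤ) ∣ D.maninConstant :=
  not_dvd_maninConstant_of_padicVal_le_of_not_dvd D hp
    (hCNS W D p hp (not_clause_two_of_cesnaviciusNeururerSahaCorrection_eq_zero hε)
      (not_clause_three_of_cesnaviciusNeururerSahaCorrection_eq_zero hε)) hdeg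

/-- Valuation form of the modular-degree key: `val_p(c(D)) = 0`.
[cite: CesnaviciusNeururerSaha2023, Thm. 1.2] -/
theorem padicValInt_maninConstant_eq_zero_of_correction_eq_zero_of_not_dvd_modularDegree
    (hCNS : cesnaviciusNeururerSaha_padicVal_maninConstant_le_modularDegree)
    (W : WeierstrassCurve ℚ) [W.IsElliptic] [W.IsGloballyMinimal] [NeZero (W.conductorNorm ℤ)]
    (D : ModularParametrizationData W (W.conductorNorm ℤ)) {p : ℕ} (hp : p.Prime)
    (hε : cesnaviciusNeururerSahaCorrection (W.conductorNorm ℤ) p = 0)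
    (hdeg : ¬ p ∣ D.modularDegree) : padicValInt p D.maninConstant = 0 := by
  haveI : Fact p.Prime := ⟨hp⟩
  exact padicValInt.eq_zero_of_not_dvd
    (not_dvd_maninConstant_of_correction_eq_zero_of_not_dvd_modularDegree hCNS W D hp hε hdeg)

/-! ### The per-class hypothesis with the modular-degree key -/

/-- **The "Edixhoven–Kodaira–twist–degree covered" classes**: at every prime `p` with `p² ∣ N(W')`,
for every globally minimal member `W'` of the isogeny class of `W`, EITHER `7 < p` and `W'` is
outside Edixhoven's printed exception at `p` (`EdixhovenNonexceptionalAt`), OR `p ≠ 2` and the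
Kodaira symbol of `W'` at `p` is `Iₙ*` for some `n ≥ 0`, OR a twist witness
`TwistSemistableWitnessAt W' p` is displayed, OR the modular-degree key: the printed correction
term of ČNS Thm. 1.2 vanishes at `(N(W'), p)` and `p ∤ deg(D')` for every lattice-optimal
`X₀(N(W'))`-parametrisation datum `D'` of `W'` (the modular degree of the optimal quotient of the
class). A predicate; nothing asserted. [cite: CesnaviciusNeururerSaha2023, Thm. 1.2]
[cite: EdixhovenManin1991, §1 and Thm. 3] [cite: SilvermanATAEC1994, IV.11.1 table p. 368] -/
def IsEdixhovenKodairaTwistDegreeCovered (W : WeierstrassCurve ℚ) : Prop :=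
  ∀ (W' : WeierstrassCurve ℚ) [W'.IsElliptic] [W'.IsGloballyMinimal], IsIsogenous W W' →
    ∀ (p : ℕ) (hp : p.Prime), p ^ 2 ∣ W'.conductorNorm ℤ →
      (7 < p ∧ EdixhovenNonexceptionalAt W' p hp) ∨
      (p ≠ 2 ∧ ∃ n : ℕ,
        W'.kodairaSymbolAt ((Rat.HeightOneSpectrum.primesEquiv (R := ℤ)).symm ⟨p, hp⟩) = .Istar n) ∨
      @TwistSemistableWitnessAt W' p ⟨hp⟩ ∨
      (cesnaviciusNeururerSahaCorrection (W'.conductorNorm ℤ) p = 0 ∧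
        ∀ [NeZero (W'.conductorNorm ℤ)] (D' : ModularParametrizationData W' (W'.conductorNorm ℤ)),
          (∀ z ∈ D'.L.lattice, ∃ w ∈ periodLattice D'.f, z = D'.c * w) → ¬ p ∣ D'.modularDegree)

/-- Unfolding of `IsEdixhovenKodairaTwistDegreeCovered` (by `Iff.rfl`).
[cite: CesnaviciusNeururerSaha2023, Thm. 1.2] -/
theorem isEdixhovenKodairaTwistDegreeCovered_iff (W : WeierstrassCurve ℚ) :
    IsEdixhovenKodairaTwistDegreeCovered W ↔
      ∀ (W' : WeierstrassCurve ℚ) [W'.IsElliptic] [W'.IsGloballyMinimal], IsIsogenous W W' →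
        ∀ (p : ℕ) (hp : p.Prime), p ^ 2 ∣ W'.conductorNorm ℤ →
          (7 < p ∧ EdixhovenNonexceptionalAt W' p hp) ∨
          (p ≠ 2 ∧ ∃ n : ℕ,
            W'.kodairaSymbolAt ((Rat.HeightOneSpectrum.primesEquiv (R := ℤ)).symm ⟨p, hp⟩) =
              .Istar n) ∨
          @TwistSemistableWitnessAt W' p ⟨hp⟩ ∨
          (cesnaviciusNeururerSahaCorrection (W'.conductorNorm ℤ) p = 0 ∧
            ∀ [NeZero (W'.conductorNorm ℤ)]
              (D' : ModularParametrizationData W' (W'.conductorNorm ℤ)),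
              (∀ z ∈ D'.L.lattice, ∃ w ∈ periodLattice D'.f, z = D'.c * w) →
                ¬ p ∣ D'.modularDegree) :=
  Iff.rfl

/-- An Edixhoven–Kodaira–twist covered class (`ManinConstantClassCertificateKodaira.lean`) is
Edixhoven–Kodaira–twist–degree covered (first three disjuncts). [cite: EdixhovenManin1991, Thm. 3] -/
theorem IsEdixhovenKodairaTwistCovered.degreeCovered {W : WeierstrassCurve ℚ}
    (h : IsEdixhovenKodairaTwistCovered W) : IsEdixhovenKodairaTwistDegreeCovered W := by
  intro W' _ _ hiso p hp hsq
  rcases h W' hiso p hp hsq with hE | hK | hT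
  · exact Or.inl hE
  · exact Or.inr (Or.inl hK)
  · exact Or.inr (Or.inr (Or.inl hT))

/-- A class all of whose minimal members carry the modular-degree key at every square prime is
Edixhoven–Kodaira–twist–degree covered (last disjunct everywhere).
[cite: CesnaviciusNeururerSaha2023, Thm. 1.2] -/
theorem isEdixhovenKodairaTwistDegreeCovered_of_forall_modularDegree {W : WeierstrassCurve ℚ}
    (h : ∀ (W' : WeierstrassCurve ℚ) [W'.IsElliptic] [W'.IsGloballyMinimal], IsIsogenous W W' →
      ∀ (p : ℕ), p.Prime → p ^ 2 ∣ W'.conductorNorm ℤ →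
        cesnaviciusNeururerSahaCorrection (W'.conductorNorm ℤ) p = 0 ∧
        ∀ [NeZero (W'.conductorNorm ℤ)] (D' : ModularParametrizationData W' (W'.conductorNorm ℤ)),
          (∀ z ∈ D'.L.lattice, ∃ w ∈ periodLattice D'.f, z = D'.c * w) → ¬ p ∣ D'.modularDegree) :
    IsEdixhovenKodairaTwistDegreeCovered W :=
  fun W' _ _ hiso p hp hsq ↦ Or.inr (Or.inr (Or.inr (h W' hiso p hp hsq)))

/-! ### The class certificate -/

/-- **`|c| = 1` for a class from: at each square prime of each minimal member, Edixhoven Thm. 3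
(`p > 7`, non-exceptional) OR Kodaira `Iₙ*` at odd `p` OR a `Γ₀` twist witness OR the
modular-degree key; every other prime by Česnavičius 2018 Thm. 1.2** — the kernel theorem, binders
`hM hAU hC hEA hEB hnf` of the `Γ₀` road plus `hCNS`. Proof: prime by prime on a lattice-optimal
datum `D'` of a globally minimal member `W'` at the conductor level (`hnf`): `p² ∤ N(W')` is
`cesnavicius2018_not_dvd_maninConstant_of_not_sq_dvd_level`; the first three keys are served exactly
as in `classAbsManinConstantEqOne_of_forall_sq_prime_edixhoven_or_kodairaIstar_or_twist_gamma0`; the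
fourth by `not_dvd_maninConstant_of_correction_eq_zero_of_not_dvd_modularDegree` on `D'` itself.
[cite: CesnaviciusNeururerSaha2023, Thm. 1.2] [cite: EdixhovenManin1991, §1 and Thm. 3]
[cite: Cesnavicius2018, Thm. 1.2] [cite: Stevens1989, Lemmas (5.2), (5.4)]
[cite: Mazur1978, Cor. 4.1] -/
theorem classAbsManinConstantEqOne_of_forall_sq_prime_edixhoven_or_kodairaIstar_or_twist_or_degree
    (hM : mazur_not_dvd_maninConstant_of_odd)
    (hAU : abbesUllmo_not_dvd_maninConstant_of_not_dvd_level)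
    (hC : cesnavicius_not_two_dvd_maninConstant_of_two_dvd_level)
    (hEA : edixhoven_not_dvd_maninConstant_of_not_potentiallyGoodOrdinary)
    (hEB : edixhoven_not_dvd_maninConstant_of_kodairaSymbol_ne)
    (hnf : exists_isNewformOf)
    (hCNS : cesnaviciusNeururerSaha_padicVal_maninConstant_le_modularDegree)
    (W : WeierstrassCurve ℚ) (hcov : IsEdixhovenKodairaTwistDegreeCovered W) :
    ClassAbsManinConstantEqOne W := by
  intro W' _ _ N' _ D' hiso hopt
  have hN' : N' = W'.conductorNorm ℤ :=
    IsNewformOf.level_eq_conductorNorm_of_exists_isNewformOf hnf D'.isNewformOf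
  subst hN'
  refine D'.abs_maninConstant_eq_one_of_forall_prime_not_dvd fun p hp ↦ ?_
  by_cases hsq : p ^ 2 ∣ W'.conductorNorm ℤ
  · rcases hcov W' hiso p hp hsq with ⟨h7, hne | hG⟩ | ⟨hp2, n, hK⟩ | htw | ⟨hε, hdeg⟩
    · exact hEB W' D' hopt p hp h7 hne.1 hne.2.1 hne.2.2
    · exact hEA W' D' hopt p hp h7 hG
    · exact not_dvd_maninConstant_of_kodairaSymbolAt_eq_Istar hM hAU hC hnf D' hopt hp hp2 hK
    · haveI : Fact p.Prime := ⟨hp⟩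
      exact not_dvd_maninConstant_of_twistSemistableWitnessAt_gamma0 hM hAU hC hnf W' D' hopt htw
    · exact not_dvd_maninConstant_of_correction_eq_zero_of_not_dvd_modularDegree hCNS W' D' hp hε
        (hdeg D' hopt)
  · exact cesnavicius2018_not_dvd_maninConstant_of_not_sq_dvd_level hM hAU hC W' D' hopt hp hsq

/-- **The class certificate BY NAME**: `IsEdixhovenKodairaTwistDegreeCovered W →
ClassAbsManinConstantEqOne W`, binders `hM hAU hC hEA hEB hnf hCNS`.
[cite: CesnaviciusNeururerSaha2023, Thm. 1.2] [cite: EdixhovenManin1991, §1 and Thm. 3]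
[cite: Cesnavicius2018, Thm. 1.2] -/
theorem classAbsManinConstantEqOne_of_isEdixhovenKodairaTwistDegreeCovered
    (hM : mazur_not_dvd_maninConstant_of_odd)
    (hAU : abbesUllmo_not_dvd_maninConstant_of_not_dvd_level)
    (hC : cesnavicius_not_two_dvd_maninConstant_of_two_dvd_level)
    (hEA : edixhoven_not_dvd_maninConstant_of_not_potentiallyGoodOrdinary)
    (hEB : edixhoven_not_dvd_maninConstant_of_kodairaSymbol_ne)
    (hnf : exists_isNewformOf)
    (hCNS : cesnaviciusNeururerSaha_padicVal_maninConstant_le_modularDegree)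
    (W : WeierstrassCurve ℚ) (hcov : IsEdixhovenKodairaTwistDegreeCovered W) :
    ClassAbsManinConstantEqOne W :=
  classAbsManinConstantEqOne_of_forall_sq_prime_edixhoven_or_kodairaIstar_or_twist_or_degree hM hAU
    hC hEA hEB hnf hCNS W hcov

/-- **Modular-degree-only form** (no Edixhoven fact among the binders): if every minimal member has
the modular-degree key at every square prime, the class has `|c| = 1`, modulo `hM hAU hC hnf hCNS`.
[cite: CesnaviciusNeururerSaha2023, Thm. 1.2] [cite: Cesnavicius2018, Thm. 1.2] -/
theorem classAbsManinConstantEqOne_of_forall_sq_prime_modularDegree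
    (hM : mazur_not_dvd_maninConstant_of_odd)
    (hAU : abbesUllmo_not_dvd_maninConstant_of_not_dvd_level)
    (hC : cesnavicius_not_two_dvd_maninConstant_of_two_dvd_level)
    (hnf : exists_isNewformOf)
    (hCNS : cesnaviciusNeururerSaha_padicVal_maninConstant_le_modularDegree)
    (W : WeierstrassCurve ℚ)
    (hcov : ∀ (W' : WeierstrassCurve ℚ) [W'.IsElliptic] [W'.IsGloballyMinimal], IsIsogenous W W' →
      ∀ (p : ℕ), p.Prime → p ^ 2 ∣ W'.conductorNorm ℤ →
        cesnaviciusNeururerSahaCorrection (W'.conductorNorm ℤ) p = 0 ∧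
        ∀ [NeZero (W'.conductorNorm ℤ)] (D' : ModularParametrizationData W' (W'.conductorNorm ℤ)),
          (∀ z ∈ D'.L.lattice, ∃ w ∈ periodLattice D'.f, z = D'.c * w) → ¬ p ∣ D'.modularDegree) :
    ClassAbsManinConstantEqOne W := by
  intro W' _ _ N' _ D' hiso hopt
  have hN' : N' = W'.conductorNorm ℤ :=
    IsNewformOf.level_eq_conductorNorm_of_exists_isNewformOf hnf D'.isNewformOf
  subst hN'
  refine D'.abs_maninConstant_eq_one_of_forall_prime_not_dvd fun p hp ↦ ?_
  by_cases hsq : p ^ 2 ∣ W'.conductorNorm ℤ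
  · obtain ⟨hε, hdeg⟩ := hcov W' hiso p hp hsq
    exact not_dvd_maninConstant_of_correction_eq_zero_of_not_dvd_modularDegree hCNS W' D' hp hε
      (hdeg D' hopt)
  · exact cesnavicius2018_not_dvd_maninConstant_of_not_sq_dvd_level hM hAU hC W' D' hopt hp hsq

/-- The binder form carried by consumers: for an Edixhoven–Kodaira–twist–degree covered class,
`p ∤ c` for EVERY prime `p` and every lattice-optimal `X₀`-datum of every globally minimal member,
modulo `hM hAU hC hEA hEB hnf hCNS`. [cite: CesnaviciusNeururerSaha2023, Thm. 1.2]
[cite: EdixhovenManin1991, §1 and Thm. 3] [cite: Cesnavicius2018, Thm. 1.2] -/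
theorem not_dvd_maninConstant_of_isEdixhovenKodairaTwistDegreeCovered
    (hM : mazur_not_dvd_maninConstant_of_odd)
    (hAU : abbesUllmo_not_dvd_maninConstant_of_not_dvd_level)
    (hC : cesnavicius_not_two_dvd_maninConstant_of_two_dvd_level)
    (hEA : edixhoven_not_dvd_maninConstant_of_not_potentiallyGoodOrdinary)
    (hEB : edixhoven_not_dvd_maninConstant_of_kodairaSymbol_ne)
    (hnf : exists_isNewformOf)
    (hCNS : cesnaviciusNeururerSaha_padicVal_maninConstant_le_modularDegree)
    {W : WeierstrassCurve ℚ} (hcov : IsEdixhovenKodairaTwistDegreeCovered W)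
    (W' : WeierstrassCurve ℚ) [W'.IsElliptic] [W'.IsGloballyMinimal] {N' : ℕ} [NeZero N']
    (D' : ModularParametrizationData W' N') (hiso : IsIsogenous W W')
    (hopt : ∀ z ∈ D'.L.lattice, ∃ w ∈ periodLattice D'.f, z = D'.c * w)
    (p : ℕ) (hp : p.Prime) : ¬ (p : ℤ) ∣ D'.maninConstant :=
  (classAbsManinConstantEqOne_of_isEdixhovenKodairaTwistDegreeCovered hM hAU hC hEA hEB hnf hCNS W
    hcov).not_dvd_maninConstant D' hiso hopt hp

/-- Valuation form: `val_p(c) = 0` at every prime for every lattice-optimal datum of every minimal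
member of a covered class. [cite: CesnaviciusNeururerSaha2023, Thm. 1.2] -/
theorem padicValInt_maninConstant_eq_zero_of_isEdixhovenKodairaTwistDegreeCovered
    (hM : mazur_not_dvd_maninConstant_of_odd)
    (hAU : abbesUllmo_not_dvd_maninConstant_of_not_dvd_level)
    (hC : cesnavicius_not_two_dvd_maninConstant_of_two_dvd_level)
    (hEA : edixhoven_not_dvd_maninConstant_of_not_potentiallyGoodOrdinary)
    (hEB : edixhoven_not_dvd_maninConstant_of_kodairaSymbol_ne)
    (hnf : exists_isNewformOf)
    (hCNS : cesnaviciusNeururerSaha_padicVal_maninConstant_le_modularDegree)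
    {W : WeierstrassCurve ℚ} (hcov : IsEdixhovenKodairaTwistDegreeCovered W)
    (W' : WeierstrassCurve ℚ) [W'.IsElliptic] [W'.IsGloballyMinimal] {N' : ℕ} [NeZero N']
    (D' : ModularParametrizationData W' N') (hiso : IsIsogenous W W')
    (hopt : ∀ z ∈ D'.L.lattice, ∃ w ∈ periodLattice D'.f, z = D'.c * w)
    (p : ℕ) (hp : p.Prime) : padicValInt p D'.maninConstant = 0 := by
  haveI : Fact p.Prime := ⟨hp⟩
  exact padicValInt.eq_zero_of_not_dvd
    (not_dvd_maninConstant_of_isEdixhovenKodairaTwistDegreeCovered hM hAU hC hEA hEB hnf hCNS hcov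
      W' D' hiso hopt p hp)

end Literature.NumberTheory.EllipticCurves.ModularForms

end
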